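import Mathlib.Algebra.MvPolynomial.Eval
import Mathlib.Algebra.MvPolynomial.Rename
import Mathlib.Algebra.MvPolynomial.Degrees
import HarnessLib

/-!
# Elusive polynomial mappings (Raz)

Topic: `Literature/Computability/AlgebraicComplexity`. Definition request `defn-IsElusive`
(route `ValiantsHypothesis/Elusive`, items stmt-ValiantsHypothesis-0338/0339/0340).

## Content

* `polyMapEval Γ : (σ → k) → (ι → k)` — the polynomial mapping defined by a tuple of polynomials
  `Γ : ι → k[σ]` (Raz 2010, §1.1).
* `IsElusive f s r` — Raz's **`(s, r)`-elusive** polynomial mappings (Raz 2010, Def. 1.1): a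
  polynomial mapping `f : kⁿ → kᵐ` is `(s, r)`-elusive if for every polynomial mapping
  `Γ : kˢ → kᵐ` of degree (at most) `r`, `Image(f) ⊄ Image(Γ)`.
* API: antitonicity in `r` and in `s` (`IsElusive.anti_right`, `IsElusive.anti_left`), and the
  trivial non-example `not_isElusive_self` (a degree-`≤ r` map in `s` variables is not
  `(s, r)`-elusive).

## Source

* R. Raz, *Elusive functions and lower bounds for arithmetic circuits*, Theory of Computing 6
  (2010), 135–177, Def. 1.1 ("degree `r`" = every coordinate polynomial has total degree at most
  `r`), §1.1.

## Design choices

* Raz works over a field; the definition makes sense over any commutative semiring `k` and is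
  stated at that generality (Mathlib style). Output coordinates `ι` and the variables `σ` of `f`
  are arbitrary types; the source dimension `s` of the competing maps `Γ` is a natural number
  (variables `Fin s`), since it is the quantity in which elusiveness is measured.
* "Degree `r`" is read as "total degree `≤ r` in every coordinate" (Raz 2010, §1.1: a polynomial
  mapping of degree `r` has all coordinates of total degree at most `r`); with `= r` the notion
  would not be antitone in `r`.
-/

noncomputable section

namespace Literature.Computability.AlgebraicComplexity

open MvPolynomial

universe u v w

variable {k : Type u} [CommSemiring k] {ι : Type v} {σ : Type w}

/-- The polynomial mapping `kˢ → kᵐ` (here `(σ → k) → (ι → k)`) defined by a tuple of polynomials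
`Γ = (Γᵢ)_{i ∈ ι}`, `y ↦ (Γᵢ(y))ᵢ` (Raz 2010, §1.1). [cite: Raz2010, §1.1] -/
def polyMapEval (Γ : ι → MvPolynomial σ k) : (σ → k) → (ι → k) :=
  fun y i => eval y (Γ i)

/-- Unfolding of `polyMapEval`. [cite: Raz2010, §1.1] -/
@[simp] theorem polyMapEval_apply (Γ : ι → MvPolynomial σ k) (y : σ → k) (i : ι) :
    polyMapEval Γ y i = eval y (Γ i) := rfl

/-- **`(s, r)`-elusive polynomial mappings** (Raz 2010, Def. 1.1): `f : kⁿ → kᵐ` (given by its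
coordinate polynomials `f : ι → k[σ]`) is `(s, r)`-elusive if for every polynomial mapping
`Γ : kˢ → kᵐ` all of whose coordinates have total degree at most `r`, the image of `f` is not
contained in the image of `Γ`. [cite: Raz2010, Def. 1.1] -/
def IsElusive (f : ι → MvPolynomial σ k) (s r : ℕ) : Prop :=
  ∀ Γ : ι → MvPolynomial (Fin s) k, (∀ i, (Γ i).totalDegree ≤ r) →
    ¬ (Set.range (polyMapEval f) ⊆ Set.range (polyMapEval Γ))

/-! ### API -/

/-- Renaming variables commutes with evaluation of polynomial mappings:
`polyMapEval (rename e ∘ Γ) y = polyMapEval Γ (y ∘ e)`. [folklore] -/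
theorem polyMapEval_rename {τ : Type*} (e : σ → τ) (Γ : ι → MvPolynomial σ k) (y : τ → k) :
    polyMapEval (fun i => rename e (Γ i)) y = polyMapEval Γ (y ∘ e) := by
  funext i
  simp [polyMapEval, eval_rename]

/-- Elusiveness is antitone in the degree bound: fewer competing maps for smaller `r`
(Raz 2010, §1.1). [cite: Raz2010, §1.1] -/
theorem IsElusive.anti_right {f : ι → MvPolynomial σ k} {s r r' : ℕ} (h : IsElusive f s r)
    (hr : r' ≤ r) : IsElusive f s r' :=
  fun Γ hΓ => h Γ fun i => (hΓ i).trans hr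

/-- Elusiveness is antitone in the source dimension: a degree-`≤ r` map `kˢ' → kᵐ` with `s' ≤ s`
is (after renaming variables along `Fin.castLE`) a degree-`≤ r` map `kˢ → kᵐ` with the same
image (Raz 2010, §1.1). [cite: Raz2010, §1.1] -/
theorem IsElusive.anti_left {f : ι → MvPolynomial σ k} {s s' r : ℕ} (h : IsElusive f s r)
    (hs : s' ≤ s) : IsElusive f s' r := by
  intro Γ hΓ hsub
  refine h (fun i => rename (Fin.castLE hs) (Γ i))
    (fun i => (totalDegree_rename_le _ _).trans (hΓ i)) (hsub.trans ?_)
  rintro _ ⟨y', rfl⟩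
  refine ⟨fun j => if hj : (j : ℕ) < s' then y' ⟨j, hj⟩ else 0, ?_⟩
  rw [polyMapEval_rename]
  congr 1
  funext j
  simp [Fin.castLE, j.2]

/-- A polynomial mapping of degree `≤ r` in `s` variables is not `(s, r)`-elusive (take `Γ = f`).
[cite: Raz2010, §1.1] -/
theorem not_isElusive_self {s r : ℕ} (f : ι → MvPolynomial (Fin s) k)
    (hf : ∀ i, (f i).totalDegree ≤ r) : ¬ IsElusive f s r :=
  fun h => h f hf subset_rfl

/-- Elusiveness only depends on the image of `f`: maps with the same image are simultaneously
elusive (Raz 2010, §1.1: the notion is a property of `Image(f)`). [cite: Raz2010, §1.1] -/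
theorem IsElusive.of_range_eq {σ' : Type*} {f : ι → MvPolynomial σ k}
    {g : ι → MvPolynomial σ' k} {s r : ℕ} (h : IsElusive f s r)
    (hfg : Set.range (polyMapEval g) = Set.range (polyMapEval f)) : IsElusive g s r :=
  fun Γ hΓ hsub => h Γ hΓ (hfg ▸ hsub)

end Literature.Computability.AlgebraicComplexity

end
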